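import Mathlib
import HarnessLib

/-!
# An elementary determinant method for diagonal ternary forms

Auxiliary file (theorems only, no definitions) for the proof of **Theorem 2 of Browning–Van
Valckenborgh 2012** (`Literature.NumberTheory.DiophantineGeometry.SquarefulSumUpperBound`,
discharged in `SquarefulSumsUpperBoundProofs`).

The printed proof [cite: BrowningValckenborgh2012, §4] rests on its Lemma 3, quoted from
Browning's *Quantitative arithmetic of projective varieties* and ultimately from Heath-Brown's
determinant method (D. R. Heath-Brown, *The density of rational points on curves and surfaces*,
Ann. of Math. 155 (2002), Theorems 2–3, key `Heathbrown2002`): for `d ≥ 2` and pairwise coprime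
non-zero `c₁, c₂, c₃`, the primitive `z ∈ ℤ³`, `|zᵢ| ≤ Zᵢ`, with `c₁z₁^d + c₂z₂^d + c₃z₃^d = 0`
number `≪_d (1 + Z₁Z₂Z₃ / |c₁c₂c₃|^{2/d})^{1/3} d^{ω(c₁c₂c₃)}`.

Neither Mathlib nor this tree has the determinant method for projective curves, so this file
proves from scratch the variant the application needs (`SquarefulDet.fiberBound`), by the
`p`-adic determinant method in its simplest (first-order Taylor) form:

* **local conditions** (`sig_pow_eq`, `dvd_minor_of_sig_eq`): if `vₖ^e ∣ cₖ` and the unknowns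
  `uᵢ, uⱼ` (`{i, j, k} = {0, 1, 2}`) are units modulo `vₖ`, then `uᵢ/uⱼ mod vₖ^e` is a `d`-th root
  of the unit `-cⱼ/cᵢ`; two solutions with the same ratio ("signature") have their `2 × 2` minor
  in the columns `i, j` divisible by `vₖ^e`, so three of them have determinant divisible by
  `vₖ^e` (`dvd_det_of_dvd_minors₀₁₂`). In the application the unknowns are pairwise coprime to the
  moduli (we are inside an `abc`-triple), which is why the full modulus `(v₀v₁v₂)^e = |c₁c₂c₃|`
  is available instead of the `|c₁c₂c₃|^{2/d}` of Lemma 3;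
* **the auxiliary prime** (`pow_three_dvd_det_of_cls`): for a prime `p ∤ d c₁c₂c₃`, three
  solutions reducing to the same point of the curve over `𝔽_p` have determinant divisible by
  `p³` (Taylor expansion to first order modulo `p²`: the solutions lie on a lattice of index
  `p³`; this is the case "`d = 1`" of [Heathbrown2002, §3]); the points over `𝔽_p` with a
  coordinate normalised to `1` number `≤ 3 d p` (`card_clsSet_le`);
* **geometry** (`abs_det_le_of_rows_le`, `card_part_le`): a determinant of three vectors of the
  box is `≤ 6 Z₀Z₁Z₂` in absolute value, so in a part (equal signature and class) it vanishes as
  soon as `6 Z₀Z₁Z₂ < (v₀v₁v₂)^e p³`; the part is then coplanar, and a plane meets the diagonal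
  curve in at most `d + 1` projective points (eliminate one coordinate: a non-zero binary form of
  degree `d`, `elimPoly_ne_zero`), each carrying `≤ 2` primitive vectors
  (`eq_or_eq_neg_of_parallel`);
* **the fibre bound** (`fiberBound`): altogether the solutions number at most
  `2(d+1) · 3dp · ∏ₖ #{ρ ∈ ℤ/vₖ^e : ρ^d = 1}`.

## Design

* Vectors are `Fin 3 → ℤ`, the degree is written `d = n + 1`, the form is `∑ i, c i * z i ^ (n+1)`
  inline (no definition is introduced), primitivity is used in Bézout form
  `∃ b, ∑ bᵢ zᵢ = 1`.
* The lattices of the determinant method are never built: only congruence classes and the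
  divisibility of `3 × 3` determinants (`Matrix.det_fin_three` and `linear_combination`).
* Coordinate permutations (`Equiv.swap`) transport the pivot-`0` computations to any pivot.

## References

* T. D. Browning, K. Van Valckenborgh, *Sums of three squareful numbers*, Exp. Math. 21 (2012)
  204–211, §4 and Lemma 3 [BrowningValckenborgh2012].
* D. R. Heath-Brown, *The density of rational points on curves and surfaces*, Ann. of Math. 155
  (2002) 553–595, Theorems 2, 3 and §3 [Heathbrown2002].
-/

namespace Literature.NumberTheory.DiophantineGeometry

namespace SquarefulDet

open Finset Matrix Polynomial

/-- `(α + pβ)^{n+1} = α^{n+1} + (n+1) αⁿ pβ + p² R`. [folklore] -/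
theorem add_mul_pow_succ_eq (α β p : ℤ) (n : ℕ) :
    ∃ R : ℤ, (α + p * β) ^ (n + 1) = α ^ (n + 1) + (n + 1) * α ^ n * (p * β) + p ^ 2 * R := by
  induction n with
  | zero => exact ⟨0, by ring⟩
  | succ n ih =>
    obtain ⟨R, hR⟩ := ih
    refine ⟨(n + 1) * α ^ n * β ^ 2 + R * (α + p * β), ?_⟩
    rw [pow_succ, hR]
    push_cast
    ring

/-- The key divisibility of the `p`-adic determinant method (Heath-Brown), class with pivot `0`:
if three integer vectors (the rows of `M`) are all `≡ (row₀) • w (mod p)` with `w 0 = 1`,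
have `p ∤ row₀` and are zeros mod `p²` of the diagonal form `∑ cᵢ zᵢ^{n+1}` (with `p ∣ F(w)`,
`p ∤ (n+1) cᵢ`), then `p³ ∣ det M`. [folklore] -/
theorem pow_three_dvd_det_of_cls_zero {n : ℕ} (c w : Fin 3 → ℤ) {p : ℤ} (hp : Prime p)
    (hw0 : w 0 = 1) (hFw : p ∣ ∑ i, c i * w i ^ (n + 1))
    (hpd : ¬ p ∣ ((n : ℤ) + 1)) (hpc : ∀ i, ¬ p ∣ c i)
    (M : Matrix (Fin 3) (Fin 3) ℤ)
    (hM1 : ∀ r, p ∣ M r 1 - M r 0 * w 1) (hM2 : ∀ r, p ∣ M r 2 - M r 0 * w 2)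
    (hM0 : ∀ r, ¬ p ∣ M r 0)
    (hMF : ∀ r, p ^ 2 ∣ ∑ i, c i * M r i ^ (n + 1)) :
    p ^ 3 ∣ M.det := by
  obtain ⟨t, ht⟩ := hFw
  simp only [Fin.sum_univ_three, hw0, one_pow, mul_one] at ht
  choose u hu using fun r => hM1 r
  choose v hv using fun r => hM2 r
  have hu' : ∀ r, M r 1 = M r 0 * w 1 + p * u r := fun r => by linarith [hu r]
  have hv' : ∀ r, M r 2 = M r 0 * w 2 + p * v r := fun r => by linarith [hv r]
  set g₁ : ℤ := (n + 1) * c 1 * w 1 ^ n with hg₁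
  set g₂ : ℤ := (n + 1) * c 2 * w 2 ^ n with hg₂
  -- the linear condition mod p in each row
  have hlin : ∀ r, p ∣ M r 0 * t + g₁ * u r + g₂ * v r := by
    intro r
    obtain ⟨R₁, hR₁⟩ := add_mul_pow_succ_eq (M r 0 * w 1) (u r) p n
    obtain ⟨R₂, hR₂⟩ := add_mul_pow_succ_eq (M r 0 * w 2) (v r) p n
    have hF := hMF r
    simp only [Fin.sum_univ_three] at hF
    rw [hu' r, hv' r, hR₁, hR₂] at hF
    have key : c 0 * M r 0 ^ (n + 1) +
        c 1 * ((M r 0 * w 1) ^ (n + 1) + (↑n + 1) * (M r 0 * w 1) ^ n * (p * u r) + p ^ 2 * R₁) +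
        c 2 * ((M r 0 * w 2) ^ (n + 1) + (↑n + 1) * (M r 0 * w 2) ^ n * (p * v r) + p ^ 2 * R₂) =
        p * (M r 0 ^ n * (M r 0 * t + g₁ * u r + g₂ * v r)) + p ^ 2 * (c 1 * R₁ + c 2 * R₂) := by
      have : c 0 * M r 0 ^ (n + 1) + c 1 * (M r 0 * w 1) ^ (n + 1) + c 2 * (M r 0 * w 2) ^ (n + 1)
          = M r 0 ^ (n + 1) * (p * t) := by rw [← ht]; ring
      rw [hg₁, hg₂]
      linear_combination this
    rw [key] at hF
    have h1 : p ^ 2 ∣ p * (M r 0 ^ n * (M r 0 * t + g₁ * u r + g₂ * v r)) :=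
      (dvd_add_left (dvd_mul_right _ _)).mp hF
    rw [pow_two] at h1
    have h2 : p ∣ M r 0 ^ n * (M r 0 * t + g₁ * u r + g₂ * v r) :=
      (mul_dvd_mul_iff_left hp.ne_zero).mp h1
    rcases hp.dvd_or_dvd h2 with h3 | h3
    · exact absurd (hp.dvd_of_dvd_pow h3) (hM0 r)
    · exact h3
  choose s hs using hlin
  -- one of g₁, g₂ is a unit mod p
  have hg : ¬ p ∣ g₁ ∨ ¬ p ∣ g₂ := by
    by_contra h
    simp only [not_or, not_not] at h
    obtain ⟨h₁, h₂⟩ := h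
    have hw1 : p ∣ w 1 := by
      rcases hp.dvd_or_dvd h₁ with h | h
      · rcases hp.dvd_or_dvd h with h | h
        · exact absurd h hpd
        · exact absurd h (hpc 1)
      · exact hp.dvd_of_dvd_pow h
    have hw2 : p ∣ w 2 := by
      rcases hp.dvd_or_dvd h₂ with h | h
      · rcases hp.dvd_or_dvd h with h | h
        · exact absurd h hpd
        · exact absurd h (hpc 2)
      · exact hp.dvd_of_dvd_pow h
    have : p ∣ c 0 := by
      have h3 : p ∣ c 1 * w 1 ^ (n + 1) + c 2 * w 2 ^ (n + 1) :=
        dvd_add (dvd_mul_of_dvd_right (dvd_pow hw1 (Nat.succ_ne_zero n)) _)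
          (dvd_mul_of_dvd_right (dvd_pow hw2 (Nat.succ_ne_zero n)) _)
      have h4 : p ∣ c 0 + (c 1 * w 1 ^ (n + 1) + c 2 * w 2 ^ (n + 1)) := ⟨t, by rw [← ht]; ring⟩
      exact (dvd_add_left h3).mp h4
    exact hpc 0 this
  have hdet : M.det = M 0 0 * (M 1 1 * M 2 2 - M 1 2 * M 2 1) - M 0 1 * (M 1 0 * M 2 2 - M 1 2 * M 2 0)
      + M 0 2 * (M 1 0 * M 2 1 - M 1 1 * M 2 0) := by
    rw [Matrix.det_fin_three]; ring
  rcases hg with hg | hg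
  · -- expand along the `u` column
    have key : g₁ * M.det = p ^ 3 * (M 0 0 * (s 1 * v 2 - v 1 * s 2) - s 0 * (M 1 0 * v 2 - v 1 * M 2 0)
        + v 0 * (M 1 0 * s 2 - s 1 * M 2 0)) := by
      rw [hdet, hu' 0, hu' 1, hu' 2, hv' 0, hv' 1, hv' 2]
      linear_combination (p ^ 2 * (-(M 1 0 * v 2 - v 1 * M 2 0))) * hs 0
        + (p ^ 2 * (M 0 0 * v 2 - v 0 * M 2 0)) * hs 1
        + (p ^ 2 * (-(M 0 0 * v 1 - v 0 * M 1 0))) * hs 2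
    exact hp.pow_dvd_of_dvd_mul_left 3 hg ⟨_, key⟩
  · -- expand along the `v` column
    have key : g₂ * M.det = p ^ 3 * (M 0 0 * (u 1 * s 2 - s 1 * u 2) - u 0 * (M 1 0 * s 2 - s 1 * M 2 0)
        + s 0 * (M 1 0 * u 2 - u 1 * M 2 0)) := by
      rw [hdet, hu' 0, hu' 1, hu' 2, hv' 0, hv' 1, hv' 2]
      linear_combination (p ^ 2 * (M 1 0 * u 2 - u 1 * M 2 0)) * hs 0
        + (p ^ 2 * (-(M 0 0 * u 2 - u 0 * M 2 0))) * hs 1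
        + (p ^ 2 * (M 0 0 * u 1 - u 0 * M 1 0)) * hs 2
    exact hp.pow_dvd_of_dvd_mul_left 3 hg ⟨_, key⟩


/-! ### B1: size of a determinant with rows in a box -/

/-- `|a b c| ≤ A B C` when `|a| ≤ A`, `|b| ≤ B`, `|c| ≤ C`. [folklore] -/
theorem abs_mul_three_le {a b c A B C : ℤ} (ha : |a| ≤ A) (hb : |b| ≤ B) (hc : |c| ≤ C) :
    |a * b * c| ≤ A * B * C := by
  rw [abs_mul, abs_mul]
  have hA : 0 ≤ A := (abs_nonneg a).trans ha
  have hB : 0 ≤ B := (abs_nonneg b).trans hb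
  exact mul_le_mul (mul_le_mul ha hb (abs_nonneg b) hA) hc (abs_nonneg c) (mul_nonneg hA hB)

/-- The determinant of three integer vectors lying in the box `|z k| ≤ Z k` is at most
`6 Z₀ Z₁ Z₂` in absolute value. [folklore] -/
theorem abs_det_le_of_rows_le (M : Matrix (Fin 3) (Fin 3) ℤ) (Z : Fin 3 → ℤ)
    (hM : ∀ r k, |M r k| ≤ Z k) : |M.det| ≤ 6 * (Z 0 * Z 1 * Z 2) := by
  have hdet : M.det = M 0 0 * M 1 1 * M 2 2 - M 0 0 * M 1 2 * M 2 1 - M 0 1 * M 1 0 * M 2 2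
      + M 0 1 * M 1 2 * M 2 0 + M 0 2 * M 1 0 * M 2 1 - M 0 2 * M 1 1 * M 2 0 := by
    linear_combination Matrix.det_fin_three M
  have h1 := abs_mul_three_le (hM 0 0) (hM 1 1) (hM 2 2)
  have h2 := abs_mul_three_le (hM 0 0) (hM 1 2) (hM 2 1)
  have h3 := abs_mul_three_le (hM 0 1) (hM 1 0) (hM 2 2)
  have h4 := abs_mul_three_le (hM 0 1) (hM 1 2) (hM 2 0)
  have h5 := abs_mul_three_le (hM 0 2) (hM 1 0) (hM 2 1)
  have h6 := abs_mul_three_le (hM 0 2) (hM 1 1) (hM 2 0)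
  rw [hdet]
  calc |M 0 0 * M 1 1 * M 2 2 - M 0 0 * M 1 2 * M 2 1 - M 0 1 * M 1 0 * M 2 2
        + M 0 1 * M 1 2 * M 2 0 + M 0 2 * M 1 0 * M 2 1 - M 0 2 * M 1 1 * M 2 0|
      ≤ |M 0 0 * M 1 1 * M 2 2| + |M 0 0 * M 1 2 * M 2 1| + |M 0 1 * M 1 0 * M 2 2|
        + |M 0 1 * M 1 2 * M 2 0| + |M 0 2 * M 1 0 * M 2 1| + |M 0 2 * M 1 1 * M 2 0| := by
        refine (abs_sub _ _).trans ?_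
        gcongr
        refine (abs_add_le _ _).trans ?_
        gcongr
        refine (abs_add_le _ _).trans ?_
        gcongr
        refine (abs_sub _ _).trans ?_
        gcongr
        exact abs_sub _ _
    _ ≤ 6 * (Z 0 * Z 1 * Z 2) := by nlinarith [h1, h2, h3, h4, h5, h6]

/-! ### B2: primitive parallel vectors coincide up to sign -/

/-- Two primitive integer vectors (in the Bézout sense) with vanishing cross product are equal up
to sign. [folklore] -/
theorem eq_or_eq_neg_of_parallel {z z' : Fin 3 → ℤ} (hz : ∃ b : Fin 3 → ℤ, ∑ i, b i * z i = 1)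
    (hz' : ∃ b : Fin 3 → ℤ, ∑ i, b i * z' i = 1)
    (h01 : z 0 * z' 1 = z 1 * z' 0) (h02 : z 0 * z' 2 = z 2 * z' 0)
    (h12 : z 1 * z' 2 = z 2 * z' 1) : z' = z ∨ z' = -z := by
  obtain ⟨b, hb⟩ := hz
  obtain ⟨b', hb'⟩ := hz'
  simp only [Fin.sum_univ_three] at hb hb'
  set k : ℤ := b 0 * z' 0 + b 1 * z' 1 + b 2 * z' 2 with hk
  set k' : ℤ := b' 0 * z 0 + b' 1 * z 1 + b' 2 * z 2 with hk'
  have h1 : ∀ j, z' j = k * z j := by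
    intro j
    fin_cases j
    · simp only [Fin.zero_eta]; linear_combination (-(z' 0)) * hb - b 1 * h01 - b 2 * h02
    · simp only [Fin.mk_one]; linear_combination (-(z' 1)) * hb + b 0 * h01 - b 2 * h12
    · simp only [Fin.reduceFinMk]; linear_combination (-(z' 2)) * hb + b 0 * h02 + b 1 * h12
  have h2 : ∀ j, z j = k' * z' j := by
    intro j
    fin_cases j
    · simp only [Fin.zero_eta]; linear_combination (-(z 0)) * hb' + b' 1 * h01 + b' 2 * h02
    · simp only [Fin.mk_one]; linear_combination (-(z 1)) * hb' - b' 0 * h01 + b' 2 * h12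
    · simp only [Fin.reduceFinMk]; linear_combination (-(z 2)) * hb' - b' 0 * h02 - b' 1 * h12
  have hkk : k' * k = 1 := by
    have e0 := h2 0; have e1 := h2 1; have e2 := h2 2
    rw [h1 0] at e0; rw [h1 1] at e1; rw [h1 2] at e2
    linear_combination (1 - k' * k) * hb - b 0 * e0 - b 1 * e1 - b 2 * e2
  rcases Int.eq_one_or_neg_one_of_mul_eq_one' hkk with ⟨-, hk1⟩ | ⟨-, hk1⟩
  · left
    funext j
    rw [h1 j, hk1, one_mul]
  · right
    funext j
    rw [h1 j, hk1, Pi.neg_apply, neg_one_mul]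

/-! ### B3: primitive points of the diagonal curve on a plane -/

/-- The binary form obtained by eliminating `z₂` from `∑ cᵢ zᵢ^{n+1} = 0` on the plane
`a·z = 0` (`a₂ ≠ 0`), dehomogenised: it is not the zero polynomial when `n ≥ 1` and all
`cᵢ ≠ 0`. [folklore] -/
theorem elimPoly_ne_zero {n : ℕ} (hn : 1 ≤ n) {c0 c1 c2 a0 a1 a2 : ℚ} (hc0 : c0 ≠ 0)
    (hc1 : c1 ≠ 0) (hc2 : c2 ≠ 0) (ha2 : a2 ≠ 0) :
    C (a2 ^ (n + 1) * c0) * X ^ (n + 1) + C c2 * (C a0 * X + C a1) ^ (n + 1)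
      + C (a2 ^ (n + 1) * c1) ≠ 0 := by
  intro hP
  by_cases ha0 : a0 = 0
  · have h := congrArg (fun P => P.coeff (n + 1)) hP
    simp only [ha0, map_zero, zero_mul, zero_add, coeff_add, coeff_C_mul, coeff_X_pow, if_true,
      mul_one, ← C_pow, coeff_C, Nat.succ_ne_zero, if_false, mul_zero, add_zero,
      coeff_zero] at h
    exact (mul_ne_zero (pow_ne_zero (n + 1) ha2) hc0) (by simpa using h)
  by_cases ha1 : a1 = 0
  · have h := congrArg (fun P => P.coeff 0) hP
    simp only [ha1, map_zero, add_zero, coeff_add, coeff_C_mul, coeff_X_pow,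
      (Nat.succ_ne_zero n).symm, if_false, mul_zero, zero_add, mul_pow, ← C_pow, coeff_C_zero,
      coeff_zero] at h
    exact (mul_ne_zero (pow_ne_zero (n + 1) ha2) hc1) (by simpa using h)
  · have h := congrArg (fun P => P.coeff 1) hP
    have hlin : C a0 * X + C a1 = C a0 * (X + C (a1 / a0)) := by
      rw [mul_add, ← C_mul, mul_div_cancel₀ _ ha0]
    have hn1 : (1 : ℕ) ≠ n + 1 := by omega
    simp only [hlin, mul_pow, ← C_pow, coeff_add, coeff_C_mul, coeff_X_pow, hn1, if_false,
      mul_zero, zero_add, coeff_X_add_C_pow, coeff_C, one_ne_zero, add_zero, coeff_zero] at h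
    simp only [Nat.choose_one_right, Nat.cast_add, Nat.cast_one, Nat.add_sub_cancel] at h
    have : c2 * (a0 ^ (n + 1) * ((a1 / a0) ^ n * (↑n + 1))) ≠ 0 := by
      have hn0 : (n : ℚ) + 1 ≠ 0 := by positivity
      have h1 : a1 / a0 ≠ 0 := div_ne_zero ha1 ha0
      exact mul_ne_zero hc2 (mul_ne_zero (pow_ne_zero _ ha0) (mul_ne_zero (pow_ne_zero _ h1) hn0))
    exact this (by simpa using h)

/-- On the plane `a·z = 0` with `a₂ ≠ 0`, the primitive integer zeros of the diagonal form
`∑ cᵢ zᵢ^{n+1}` (`n ≥ 1`, `cᵢ ≠ 0`) number at most `2 (n + 2)`. [folklore] -/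
theorem card_le_of_plane_two {n : ℕ} (hn : 1 ≤ n) (c : Fin 3 → ℤ) (hc : ∀ i, c i ≠ 0)
    (a : Fin 3 → ℤ) (ha : a 2 ≠ 0) (T : Finset (Fin 3 → ℤ))
    (hprim : ∀ z ∈ T, ∃ b : Fin 3 → ℤ, ∑ i, b i * z i = 1)
    (hF : ∀ z ∈ T, ∑ i, c i * z i ^ (n + 1) = 0)
    (hplane : ∀ z ∈ T, ∑ i, a i * z i = 0) :
    T.card ≤ 2 * (n + 2) := by
  classical
  -- the chart `z ↦ z₀/z₁`
  let φ : (Fin 3 → ℤ) → Option ℚ := fun z => if z 1 = 0 then none else some ((z 0 : ℚ) / z 1)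
  -- fibres have at most two elements
  have hfib : ∀ z ∈ T, ∀ z' ∈ T, φ z = φ z' → z' = z ∨ z' = -z := by
    intro z hz z' hz' hφ
    have hpz := hplane z hz
    have hpz' := hplane z' hz'
    simp only [Fin.sum_univ_three] at hpz hpz'
    refine eq_or_eq_neg_of_parallel (hprim z hz) (hprim z' hz') ?_ ?_ ?_
    all_goals by_cases h1 : z 1 = 0
    all_goals by_cases h1' : z' 1 = 0
    all_goals simp only [φ, h1, h1', if_true, if_false, reduceCtorEq, Option.some.injEq] at hφ
    · rw [h1, h1']; ring
    · rw [div_eq_div_iff (by exact_mod_cast h1) (by exact_mod_cast h1')] at hφ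
      exact_mod_cast (by linear_combination hφ : (z 0 : ℚ) * z' 1 = z 1 * z' 0)
    · have : a 2 * (z 0 * z' 2 - z 2 * z' 0) = 0 := by
        linear_combination z 0 * hpz' - z' 0 * hpz + (a 1 * z' 0) * h1 - (a 1 * z 0) * h1'
      rcases mul_eq_zero.mp this with h | h
      · exact absurd h ha
      · linarith
    · rw [div_eq_div_iff (by exact_mod_cast h1) (by exact_mod_cast h1')] at hφ
      have h01 : z 0 * z' 1 = z 1 * z' 0 := by
        exact_mod_cast (by linear_combination hφ : (z 0 : ℚ) * z' 1 = z 1 * z' 0)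
      have : a 2 * (z 0 * z' 2 - z 2 * z' 0) = 0 := by
        linear_combination z 0 * hpz' - z' 0 * hpz - a 1 * h01
      rcases mul_eq_zero.mp this with h | h
      · exact absurd h ha
      · linarith
    · rw [h1, h1']; ring
    · rw [div_eq_div_iff (by exact_mod_cast h1) (by exact_mod_cast h1')] at hφ
      have h01 : z 0 * z' 1 = z 1 * z' 0 := by
        exact_mod_cast (by linear_combination hφ : (z 0 : ℚ) * z' 1 = z 1 * z' 0)
      have : a 2 * (z 1 * z' 2 - z 2 * z' 1) = 0 := by
        linear_combination z 1 * hpz' - z' 1 * hpz + a 0 * h01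
      rcases mul_eq_zero.mp this with h | h
      · exact absurd h ha
      · linarith
  have hfib2 : ∀ q ∈ T.image φ, (T.filter fun z => φ z = q).card ≤ 2 := by
    intro q hq
    obtain ⟨z₀, hz₀, rfl⟩ := Finset.mem_image.mp hq
    calc (T.filter fun z => φ z = φ z₀).card ≤ ({z₀, -z₀} : Finset (Fin 3 → ℤ)).card := by
          refine Finset.card_le_card fun z hz => ?_
          rw [Finset.mem_filter] at hz
          rcases hfib z₀ hz₀ z hz.1 hz.2.symm with h | h
          · simp [h]
          · simp [h]
      _ ≤ 2 := Finset.card_le_two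
  -- the image lies in `{∞} ∪ roots P`
  set P : ℚ[X] := C ((a 2 : ℚ) ^ (n + 1) * c 0) * X ^ (n + 1)
    + C (c 2 : ℚ) * (C (-(a 0 : ℚ)) * X + C (-(a 1 : ℚ))) ^ (n + 1)
    + C ((a 2 : ℚ) ^ (n + 1) * c 1) with hP
  have hP0 : P ≠ 0 := elimPoly_ne_zero hn (by exact_mod_cast hc 0) (by exact_mod_cast hc 1)
    (by exact_mod_cast hc 2) (by exact_mod_cast ha)
  have hdeg : P.natDegree ≤ n + 1 := by
    rw [hP]
    refine (natDegree_add_le _ _).trans (max_le ((natDegree_add_le _ _).trans (max_le ?_ ?_)) ?_)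
    · exact (natDegree_C_mul_le _ _).trans (natDegree_X_pow_le _)
    · refine (natDegree_C_mul_le _ _).trans ((natDegree_pow_le).trans ?_)
      have : (C (-(a 0 : ℚ)) * X + C (-(a 1 : ℚ))).natDegree ≤ 1 := by
        refine (natDegree_add_le _ _).trans (max_le ?_ ?_)
        · exact (natDegree_C_mul_le _ _).trans natDegree_X_le
        · exact (natDegree_C _).le.trans zero_le_one
      calc (n + 1) * (C (-(a 0 : ℚ)) * X + C (-(a 1 : ℚ))).natDegree ≤ (n + 1) * 1 :=
            Nat.mul_le_mul_left _ this
        _ = n + 1 := mul_one _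
    · exact (natDegree_C _).le.trans (Nat.zero_le _)
  have himage : T.image φ ⊆ insert none (P.roots.toFinset.image some) := by
    intro q hq
    obtain ⟨z, hz, rfl⟩ := Finset.mem_image.mp hq
    by_cases h1 : z 1 = 0
    · simp [φ, h1]
    · simp only [φ, h1, if_false]
      refine Finset.mem_insert_of_mem (Finset.mem_image_of_mem _ ?_)
      rw [Multiset.mem_toFinset, mem_roots hP0, IsRoot.def]
      have hFz := hF z hz
      have hpz := hplane z hz
      simp only [Fin.sum_univ_three] at hFz hpz
      have hz1 : (z 1 : ℚ) ≠ 0 := by exact_mod_cast h1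
      -- the integer identity `A z₀^d + c₂ (-a₀z₀ - a₁z₁)^d + B z₁^d = 0`
      have hint : (a 2 : ℚ) ^ (n + 1) * c 0 * (z 0 : ℚ) ^ (n + 1)
          + (c 2 : ℚ) * (-(a 0 : ℚ) * z 0 + -(a 1 : ℚ) * z 1) ^ (n + 1)
          + (a 2 : ℚ) ^ (n + 1) * c 1 * (z 1 : ℚ) ^ (n + 1) = 0 := by
        have e2 : -(a 0 : ℚ) * z 0 + -(a 1 : ℚ) * z 1 = (a 2 : ℚ) * z 2 := by
          have : ((-a 0 * z 0 + -a 1 * z 1 : ℤ) : ℚ) = ((a 2 * z 2 : ℤ) : ℚ) := by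
            congr 1; linarith
          push_cast at this; exact this
        rw [e2]
        have : ((c 0 * z 0 ^ (n + 1) + c 1 * z 1 ^ (n + 1) + c 2 * z 2 ^ (n + 1) : ℤ) : ℚ) = 0 := by
          exact_mod_cast hFz
        push_cast at this
        simp only [mul_pow]
        linear_combination (a 2 : ℚ) ^ (n + 1) * this
      have hr : (z 0 : ℚ) / z 1 * z 1 = z 0 := div_mul_cancel₀ _ hz1
      have e : (-(a 0 : ℚ) * ((z 0 : ℚ) / z 1) + -(a 1 : ℚ)) * z 1
          = -(a 0 : ℚ) * z 0 + -(a 1 : ℚ) * z 1 := by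
        rw [add_mul, mul_assoc, hr]
      have heval : P.eval ((z 0 : ℚ) / z 1) * (z 1 : ℚ) ^ (n + 1) =
          (a 2 : ℚ) ^ (n + 1) * c 0 * ((z 0 : ℚ) / z 1 * z 1) ^ (n + 1)
          + (c 2 : ℚ) * ((-(a 0 : ℚ) * ((z 0 : ℚ) / z 1) + -(a 1 : ℚ)) * z 1) ^ (n + 1)
          + (a 2 : ℚ) ^ (n + 1) * c 1 * (z 1 : ℚ) ^ (n + 1) := by
        simp only [hP, eval_add, eval_mul, eval_C, eval_pow, eval_X, mul_pow]
        ring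
      rw [hr, e, hint] at heval
      rcases mul_eq_zero.mp heval with h | h
      · exact h
      · exact absurd (pow_eq_zero_iff (Nat.succ_ne_zero n) |>.mp h) hz1
  calc T.card ≤ 2 * (T.image φ).card := Finset.card_le_mul_card_image T 2 hfib2
    _ ≤ 2 * (n + 2) := by
        gcongr
        calc (T.image φ).card ≤ (insert none (P.roots.toFinset.image some)).card :=
              Finset.card_le_card himage
          _ ≤ (P.roots.toFinset.image some).card + 1 := Finset.card_insert_le _ _
          _ ≤ P.roots.toFinset.card + 1 := by gcongr; exact Finset.card_image_le
          _ ≤ (n + 1) + 1 := by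
              gcongr
              exact (Multiset.toFinset_card_le _).trans ((card_roots' P).trans hdeg)
          _ = n + 2 := by ring


/-! ### Transport under coordinate permutations -/

/-- Rows precomposed with a permutation of the coordinates form the column-permuted matrix.
[folklore] -/
theorem of_comp_perm_eq_submatrix (z₁ z₂ z₃ : Fin 3 → ℤ) (σ : Equiv.Perm (Fin 3)) :
    Matrix.of ![z₁ ∘ σ, z₂ ∘ σ, z₃ ∘ σ] = (Matrix.of ![z₁, z₂, z₃]).submatrix id σ := by
  ext i j
  fin_cases i <;> rfl

/-- Precomposition with a permutation is injective on vectors. [folklore] -/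
theorem comp_perm_injective (σ : Equiv.Perm (Fin 3)) :
    Function.Injective fun z : Fin 3 → ℤ => z ∘ σ := by
  intro z w h
  funext i
  have := congrFun h (σ.symm i)
  simpa using this

/-- `card_le_of_plane_two` for an arbitrary pivot coordinate `k` with `a k ≠ 0`. [folklore] -/
theorem card_le_of_plane {n : ℕ} (hn : 1 ≤ n) (c : Fin 3 → ℤ) (hc : ∀ i, c i ≠ 0)
    (a : Fin 3 → ℤ) (k : Fin 3) (ha : a k ≠ 0) (T : Finset (Fin 3 → ℤ))
    (hprim : ∀ z ∈ T, ∃ b : Fin 3 → ℤ, ∑ i, b i * z i = 1)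
    (hF : ∀ z ∈ T, ∑ i, c i * z i ^ (n + 1) = 0)
    (hplane : ∀ z ∈ T, ∑ i, a i * z i = 0) :
    T.card ≤ 2 * (n + 2) := by
  classical
  set σ : Equiv.Perm (Fin 3) := Equiv.swap k 2 with hσ
  have hσ2 : σ 2 = k := by simp [hσ, Equiv.swap_apply_right]
  have hcard : (T.image fun z => z ∘ σ).card = T.card :=
    Finset.card_image_of_injective _ (comp_perm_injective σ)
  rw [← hcard]
  refine card_le_of_plane_two hn (c ∘ σ) (fun i => hc _) (a ∘ σ) (by simpa [hσ2] using ha) _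
    ?_ ?_ ?_
  · intro z' hz'
    obtain ⟨z, hz, rfl⟩ := Finset.mem_image.mp hz'
    obtain ⟨b, hb⟩ := hprim z hz
    exact ⟨b ∘ σ, by rw [← hb]; exact Equiv.sum_comp σ (fun i => b i * z i)⟩
  · intro z' hz'
    obtain ⟨z, hz, rfl⟩ := Finset.mem_image.mp hz'
    rw [← hF z hz]
    exact Equiv.sum_comp σ (fun i => c i * z i ^ (n + 1))
  · intro z' hz'
    obtain ⟨z, hz, rfl⟩ := Finset.mem_image.mp hz'
    rw [← hplane z hz]
    exact Equiv.sum_comp σ (fun i => a i * z i)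

/-- `pow_three_dvd_det_of_cls_zero` for an arbitrary pivot coordinate `i₀`. [folklore] -/
theorem pow_three_dvd_det_of_cls {n : ℕ} (c w : Fin 3 → ℤ) {p : ℤ} (hp : Prime p)
    (i₀ : Fin 3) (hw0 : w i₀ = 1) (hFw : p ∣ ∑ i, c i * w i ^ (n + 1))
    (hpd : ¬ p ∣ ((n : ℤ) + 1)) (hpc : ∀ i, ¬ p ∣ c i)
    (M : Matrix (Fin 3) (Fin 3) ℤ)
    (hM : ∀ r k, p ∣ M r k - M r i₀ * w k) (hM0 : ∀ r, ¬ p ∣ M r i₀)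
    (hMF : ∀ r, p ^ 2 ∣ ∑ i, c i * M r i ^ (n + 1)) :
    p ^ 3 ∣ M.det := by
  set σ : Equiv.Perm (Fin 3) := Equiv.swap 0 i₀ with hσ
  have hσ0 : σ 0 = i₀ := by simp [hσ, Equiv.swap_apply_left]
  have h := pow_three_dvd_det_of_cls_zero (n := n) (c ∘ σ) (w ∘ σ) hp
    (by simpa [hσ0] using hw0)
    (by
      simp only [Function.comp_apply]
      rw [Equiv.sum_comp σ (fun i => c i * w i ^ (n + 1))]; exact hFw) hpd (fun i => hpc _)
    (M.submatrix id σ)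
    (fun r => by simpa [Matrix.submatrix_apply, hσ0] using hM r (σ 1))
    (fun r => by simpa [Matrix.submatrix_apply, hσ0] using hM r (σ 2))
    (fun r => by simpa [Matrix.submatrix_apply, hσ0] using hM0 r)
    (fun r => by
      simp only [Matrix.submatrix_apply, id, Function.comp_apply]
      rw [Equiv.sum_comp σ (fun i => c i * M r i ^ (n + 1))]
      exact hMF r)
  rw [Matrix.det_permute'] at h
  have hs : ((Equiv.Perm.sign σ : ℤˣ) : ℤ) * ((Equiv.Perm.sign σ : ℤˣ) : ℤ) = 1 := by
    rw [← Units.val_mul, Int.units_mul_self, Units.val_one]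
  have : M.det = ((Equiv.Perm.sign σ : ℤˣ) : ℤ) * (((Equiv.Perm.sign σ : ℤˣ) : ℤ) * M.det) := by
    rw [← mul_assoc, hs, one_mul]
  rw [this]
  exact h.mul_left _

/-! ### Parts: coplanar primitive zeros -/

/-- A set of primitive integer zeros of the diagonal form `∑ cᵢ zᵢ^{n+1}` (`n ≥ 1`, `cᵢ ≠ 0`)
any three of which are linearly dependent has at most `2 (n + 2)` elements. [folklore] -/
theorem card_part_le {n : ℕ} (hn : 1 ≤ n) (c : Fin 3 → ℤ) (hc : ∀ i, c i ≠ 0)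
    (T : Finset (Fin 3 → ℤ))
    (hprim : ∀ z ∈ T, ∃ b : Fin 3 → ℤ, ∑ i, b i * z i = 1)
    (hF : ∀ z ∈ T, ∑ i, c i * z i ^ (n + 1) = 0)
    (hdet : ∀ z₁ ∈ T, ∀ z₂ ∈ T, ∀ z₃ ∈ T, (Matrix.of ![z₁, z₂, z₃]).det = 0) :
    T.card ≤ 2 * (n + 2) := by
  classical
  by_cases hpar : ∀ z₁ ∈ T, ∀ z₂ ∈ T, z₁ 0 * z₂ 1 = z₁ 1 * z₂ 0 ∧ z₁ 0 * z₂ 2 = z₁ 2 * z₂ 0 ∧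
      z₁ 1 * z₂ 2 = z₁ 2 * z₂ 1
  · -- all elements are parallel
    rcases T.eq_empty_or_nonempty with hT | ⟨z₁, hz₁⟩
    · simp [hT]
    · calc T.card ≤ ({z₁, -z₁} : Finset (Fin 3 → ℤ)).card := by
            refine Finset.card_le_card fun z hz => ?_
            obtain ⟨h01, h02, h12⟩ := hpar z₁ hz₁ z hz
            rcases eq_or_eq_neg_of_parallel (hprim z₁ hz₁) (hprim z hz) h01 h02 h12 with h | h
            · simp [h]
            · simp [h]
        _ ≤ 2 := Finset.card_le_two
        _ ≤ 2 * (n + 2) := by omega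
  · simp only [not_forall] at hpar
    obtain ⟨z₁, hz₁, z₂, hz₂, hne⟩ := hpar
    -- the normal vector of the plane spanned by `z₁, z₂`
    set a : Fin 3 → ℤ := ![z₁ 1 * z₂ 2 - z₁ 2 * z₂ 1, z₁ 2 * z₂ 0 - z₁ 0 * z₂ 2,
      z₁ 0 * z₂ 1 - z₁ 1 * z₂ 0] with ha_def
    have ha0 : a 0 = z₁ 1 * z₂ 2 - z₁ 2 * z₂ 1 := rfl
    have ha1 : a 1 = z₁ 2 * z₂ 0 - z₁ 0 * z₂ 2 := rfl
    have ha2 : a 2 = z₁ 0 * z₂ 1 - z₁ 1 * z₂ 0 := rfl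
    have ha : ∃ k, a k ≠ 0 := by
      by_contra h
      simp only [not_exists, not_not] at h
      have h0 := h 0; have h1 := h 1; have h2 := h 2
      rw [ha0] at h0; rw [ha1] at h1; rw [ha2] at h2
      exact hne ⟨by linarith, by linarith, by linarith⟩
    obtain ⟨k, hk⟩ := ha
    refine card_le_of_plane hn c hc a k hk T hprim hF ?_
    intro z hz
    have h := hdet z hz z₁ hz₁ z₂ hz₂
    rw [Matrix.det_fin_three] at h
    simp only [Matrix.of_apply, Matrix.cons_val_zero, Matrix.cons_val_one, Matrix.cons_val_two,
      Matrix.head_cons, Matrix.tail_cons] at h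
    simp only [Fin.sum_univ_three, ha0, ha1, ha2]
    linear_combination h

/-! ### Local conditions modulo the coefficients: signatures -/

/-- For an integer `b` coprime to `m`, `b · b⁻¹ = 1` in `ZMod m` (with the inverse function of
`ZMod m`). [folklore] -/
theorem mul_inv_cast_eq_one_of_isCoprime {m : ℕ} {b : ℤ} (h : IsCoprime b m) :
    (b : ZMod m) * ((b : ZMod m))⁻¹ = 1 := by
  obtain ⟨x, y, hxy⟩ := h
  have h1 := congrArg (Int.cast : ℤ → ZMod m) hxy
  push_cast at h1
  rw [ZMod.natCast_self, mul_zero, add_zero] at h1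
  exact ZMod.mul_inv_of_unit _ (IsUnit.of_mul_eq_one x (by rw [mul_comm]; exact h1))

/-- The signature relation: if `m ∣ cᵢ a^d + cⱼ b^d` with `b, cᵢ` units mod `m`, then
`(a/b)^d = -cⱼ/cᵢ` in `ZMod m`. [folklore] -/
theorem sig_pow_eq {m d : ℕ} (a b ci cj : ℤ) (hb : IsCoprime b m) (hci : IsCoprime ci m)
    (h : (m : ℤ) ∣ ci * a ^ d + cj * b ^ d) :
    ((a : ZMod m) * ((b : ZMod m))⁻¹) ^ d = -(cj : ZMod m) * ((ci : ZMod m))⁻¹ := by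
  have hb1 : (b : ZMod m) * ((b : ZMod m))⁻¹ = 1 :=
    mul_inv_cast_eq_one_of_isCoprime hb
  have hci1 : (ci : ZMod m) * ((ci : ZMod m))⁻¹ = 1 :=
    mul_inv_cast_eq_one_of_isCoprime hci
  have hsum : (ci : ZMod m) * (a : ZMod m) ^ d = -((cj : ZMod m) * (b : ZMod m) ^ d) := by
    have := (ZMod.intCast_zmod_eq_zero_iff_dvd _ m).mpr h
    push_cast at this
    linear_combination this
  calc ((a : ZMod m) * ((b : ZMod m))⁻¹) ^ d
      = ((a : ZMod m) * ((b : ZMod m))⁻¹) ^ d * ((ci : ZMod m) * ((ci : ZMod m))⁻¹)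
          * ((b : ZMod m) * ((b : ZMod m))⁻¹) ^ d := by rw [hci1, hb1, one_pow, mul_one, mul_one]
    _ = ((ci : ZMod m) * (a : ZMod m) ^ d) * ((ci : ZMod m))⁻¹ * ((b : ZMod m))⁻¹ ^ d
          * ((b : ZMod m) * ((b : ZMod m))⁻¹) ^ d := by ring
    _ = -(cj : ZMod m) * ((ci : ZMod m))⁻¹
          * (((b : ZMod m) * ((b : ZMod m))⁻¹) * ((b : ZMod m) * ((b : ZMod m))⁻¹)) ^ d := by
          rw [hsum]; ring
    _ = -(cj : ZMod m) * ((ci : ZMod m))⁻¹ := by rw [hb1, one_mul, one_pow, mul_one]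

/-- Equal signatures force the `2 × 2` minor to vanish modulo `m`. [folklore] -/
theorem dvd_minor_of_sig_eq {m : ℕ} [NeZero m] (a b a' b' : ℤ) (hb : IsCoprime b m)
    (hb' : IsCoprime b' m)
    (h : (a : ZMod m) * ((b : ZMod m))⁻¹ = (a' : ZMod m) * ((b' : ZMod m))⁻¹) :
    (m : ℤ) ∣ a * b' - a' * b := by
  have hb1 : (b : ZMod m) * ((b : ZMod m))⁻¹ = 1 :=
    mul_inv_cast_eq_one_of_isCoprime hb
  have hb1' : (b' : ZMod m) * ((b' : ZMod m))⁻¹ = 1 :=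
    mul_inv_cast_eq_one_of_isCoprime hb'
  rw [← ZMod.intCast_zmod_eq_zero_iff_dvd]
  push_cast
  calc (a : ZMod m) * b' - a' * b
      = ((a : ZMod m) * ((b : ZMod m))⁻¹) * b' * b - a' * b * 1 := by
        rw [mul_one]
        congr 1
        calc (a : ZMod m) * b' = a * ((b : ZMod m) * ((b : ZMod m))⁻¹) * b' := by
              rw [hb1, mul_one]
          _ = _ := by ring
    _ = ((a' : ZMod m) * ((b' : ZMod m))⁻¹) * b' * b - a' * b * 1 := by rw [h]
    _ = (a' : ZMod m) * b * ((b' : ZMod m) * ((b' : ZMod m))⁻¹) - a' * b * 1 := by ring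
    _ = 0 := by rw [hb1']; ring

/-- Column expansion along column `0`: minors in columns `1, 2`. [folklore] -/
theorem dvd_det_of_dvd_minors₀ (M : Matrix (Fin 3) (Fin 3) ℤ) (m : ℤ)
    (h : ∀ r s, m ∣ M r 1 * M s 2 - M s 1 * M r 2) : m ∣ M.det := by
  have : M.det = M 0 0 * (M 1 1 * M 2 2 - M 2 1 * M 1 2) - M 1 0 * (M 0 1 * M 2 2 - M 2 1 * M 0 2)
      + M 2 0 * (M 0 1 * M 1 2 - M 1 1 * M 0 2) := by
    linear_combination Matrix.det_fin_three M
  rw [this]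
  exact dvd_add (dvd_sub (dvd_mul_of_dvd_right (h 1 2) _) (dvd_mul_of_dvd_right (h 0 2) _))
    (dvd_mul_of_dvd_right (h 0 1) _)

/-- Column expansion along column `1`: minors in columns `0, 2`. [folklore] -/
theorem dvd_det_of_dvd_minors₁ (M : Matrix (Fin 3) (Fin 3) ℤ) (m : ℤ)
    (h : ∀ r s, m ∣ M r 0 * M s 2 - M s 0 * M r 2) : m ∣ M.det := by
  have : M.det = -(M 0 1 * (M 1 0 * M 2 2 - M 2 0 * M 1 2)) + M 1 1 * (M 0 0 * M 2 2 - M 2 0 * M 0 2)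
      - M 2 1 * (M 0 0 * M 1 2 - M 1 0 * M 0 2) := by
    linear_combination Matrix.det_fin_three M
  rw [this]
  exact dvd_sub (dvd_add (dvd_neg.2 (dvd_mul_of_dvd_right (h 1 2) _))
    (dvd_mul_of_dvd_right (h 0 2) _)) (dvd_mul_of_dvd_right (h 0 1) _)

/-- Column expansion along column `2`: minors in columns `0, 1`. [folklore] -/
theorem dvd_det_of_dvd_minors₂ (M : Matrix (Fin 3) (Fin 3) ℤ) (m : ℤ)
    (h : ∀ r s, m ∣ M r 0 * M s 1 - M s 0 * M r 1) : m ∣ M.det := by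
  have : M.det = M 0 2 * (M 1 0 * M 2 1 - M 2 0 * M 1 1) - M 1 2 * (M 0 0 * M 2 1 - M 2 0 * M 0 1)
      + M 2 2 * (M 0 0 * M 1 1 - M 1 0 * M 0 1) := by
    linear_combination Matrix.det_fin_three M
  rw [this]
  exact dvd_add (dvd_sub (dvd_mul_of_dvd_right (h 1 2) _) (dvd_mul_of_dvd_right (h 0 2) _))
    (dvd_mul_of_dvd_right (h 0 1) _)

/-- A coset count: the `d`-th roots of a unit are at most as many as the `d`-th roots of unity.
[folklore] -/
theorem card_filter_pow_eq_le {m d : ℕ} [NeZero m] (U : ZMod m) (hU : IsUnit U) (hd : d ≠ 0) :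
    #{ρ : ZMod m | ρ ^ d = U} ≤ Nat.card {ρ : ZMod m // ρ ^ d = 1} := by
  classical
  rw [Nat.card_eq_fintype_card, Fintype.card_subtype]
  rcases (Finset.univ.filter fun ρ : ZMod m => ρ ^ d = U).eq_empty_or_nonempty with h0 | ⟨ρ₀, hρ₀⟩
  · rw [h0]; exact Nat.zero_le _
  · rw [Finset.mem_filter] at hρ₀
    have hu : IsUnit ρ₀ := (isUnit_pow_iff hd).mp (hρ₀.2 ▸ hU)
    obtain ⟨ρ₁, hρ₁⟩ := hu.exists_right_inv
    refine Finset.card_le_card_of_injOn (fun ρ => ρ * ρ₁) (fun ρ hρ => ?_) (fun ρ hρ ρ' hρ' h => ?_)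
    · simp only [Finset.coe_filter, Finset.mem_univ, true_and, Set.mem_setOf_eq] at hρ ⊢
      rw [mul_pow, hρ, ← hρ₀.2, ← mul_pow, hρ₁, one_pow]
    · have := congrArg (· * ρ₀) h
      simpa only [mul_assoc, mul_comm ρ₁, hρ₁, mul_one] using this

/-- Sum over `Fin 3` through a covering triple of distinct indices. [folklore] -/
theorem sum_eq_of_cover {α : Type*} [AddCommMonoid α] (f : Fin 3 → α) (i j k : Fin 3)
    (hij : i ≠ j) (hik : i ≠ k) (hjk : j ≠ k) : ∑ l, f l = f i + f j + f k := by
  have huniv : (Finset.univ : Finset (Fin 3)) = {i, j, k} := by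
    refine (Finset.eq_of_subset_of_card_le (Finset.subset_univ _) ?_).symm
    rw [Finset.card_univ, Fintype.card_fin, Finset.card_insert_of_notMem (by simp [hij, hik]),
      Finset.card_pair hjk]
  rw [huniv, Finset.sum_insert (by simp [hij, hik]), Finset.sum_pair hjk, add_assoc]

/-- Points of the diagonal curve over `𝔽_p` with a coordinate normalised to `1`: at most
`(n+1) p` of them. [folklore] -/
theorem card_cls_le {p : ℕ} [Fact p.Prime] {n : ℕ} (c : Fin 3 → ZMod p) (i j k : Fin 3)
    (hij : i ≠ j) (hik : i ≠ k) (hjk : j ≠ k) (hck : c k ≠ 0) :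
    #{w : Fin 3 → ZMod p | w i = 1 ∧ ∑ l, c l * w l ^ (n + 1) = 0} ≤ (n + 1) * p := by
  classical
  have hcover : ∀ l : Fin 3, l = i ∨ l = j ∨ l = k := by
    intro l
    fin_cases i <;> fin_cases j <;> fin_cases k <;> fin_cases l <;> simp_all
  set W := (Finset.univ.filter fun w : Fin 3 → ZMod p => w i = 1 ∧ ∑ l, c l * w l ^ (n + 1) = 0)
    with hW
  calc #W ≤ (n + 1) * #(W.image fun w => w j) := by
        refine Finset.card_le_mul_card_image W (n + 1) fun s hs => ?_
        -- the fibre over `s` injects into the roots of `c_k X^{n+1} + (c_i + c_j s^{n+1})`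
        set P : (ZMod p)[X] := C (c k) * X ^ (n + 1) + C (c i + c j * s ^ (n + 1)) with hP
        have hP0 : P ≠ 0 := by
          intro h
          have := congrArg (fun P => P.coeff (n + 1)) h
          simp only [hP, coeff_add, coeff_C_mul, coeff_X_pow, if_true, mul_one, coeff_C,
            Nat.succ_ne_zero, if_false, add_zero, coeff_zero] at this
          exact hck this
        have hdeg : P.natDegree ≤ n + 1 := by
          rw [hP]
          refine (natDegree_add_le _ _).trans (max_le ?_ ?_)
          · exact (natDegree_C_mul_le _ _).trans (natDegree_X_pow_le _)
          · exact (natDegree_C _).le.trans (Nat.zero_le _)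
        calc #(W.filter fun w => w j = s) ≤ #P.roots.toFinset := by
              refine Finset.card_le_card_of_injOn (fun w => w k) (fun w hw => ?_)
                (fun w hw w' hw' h => ?_)
              · simp only [Finset.coe_filter, hW, Finset.mem_filter, Finset.mem_univ, true_and,
                  Set.mem_setOf_eq] at hw
                obtain ⟨⟨hwi, hwF⟩, hwj⟩ := hw
                simp only [Finset.mem_coe, Multiset.mem_toFinset]
                rw [mem_roots hP0, IsRoot.def]
                simp only [hP, eval_add, eval_mul, eval_C, eval_pow, eval_X]
                rw [sum_eq_of_cover _ i j k hij hik hjk, hwi, hwj, one_pow, mul_one] at hwF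
                linear_combination hwF
              · simp only [Finset.coe_filter, hW, Finset.mem_filter, Finset.mem_univ, true_and,
                  Set.mem_setOf_eq] at hw hw'
                funext l
                rcases hcover l with rfl | rfl | rfl
                · rw [hw.1.1, hw'.1.1]
                · rw [hw.2, hw'.2]
                · exact h
          _ ≤ n + 1 := (Multiset.toFinset_card_le _).trans ((card_roots' P).trans hdeg)
    _ ≤ (n + 1) * p := by
        gcongr
        calc #(W.image fun w => w j) ≤ #(Finset.univ : Finset (ZMod p)) :=
              Finset.card_le_univ _
          _ = p := by rw [Finset.card_univ, ZMod.card]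

/-- The classes `(i, w)`, `w i = 1`, `w` on the diagonal curve mod `p`: at most `3 (n+1) p`.
[folklore] -/
theorem card_clsSet_le {p : ℕ} [Fact p.Prime] {n : ℕ} (c : Fin 3 → ZMod p) (hc : ∀ k, c k ≠ 0) :
    #{q : Fin 3 × (Fin 3 → ZMod p) | q.2 q.1 = 1 ∧ ∑ l, c l * q.2 l ^ (n + 1) = 0}
      ≤ 3 * ((n + 1) * p) := by
  classical
  have hsub : (Finset.univ.filter fun q : Fin 3 × (Fin 3 → ZMod p) =>
      q.2 q.1 = 1 ∧ ∑ l, c l * q.2 l ^ (n + 1) = 0) ⊆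
      Finset.univ.biUnion fun i : Fin 3 => (Finset.univ.filter fun w : Fin 3 → ZMod p =>
        w i = 1 ∧ ∑ l, c l * w l ^ (n + 1) = 0).image fun w => (i, w) := by
    rintro ⟨i, w⟩ hq
    simp only [Finset.mem_filter, Finset.mem_univ, true_and] at hq
    simp only [Finset.mem_biUnion, Finset.mem_univ, Finset.mem_image, Finset.mem_filter, true_and,
      Prod.mk.injEq]
    exact ⟨i, w, hq, rfl, rfl⟩
  refine (Finset.card_le_card hsub).trans ((Finset.card_biUnion_le).trans ?_)
  calc ∑ i : Fin 3, #((Finset.univ.filter fun w : Fin 3 → ZMod p =>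
          w i = 1 ∧ ∑ l, c l * w l ^ (n + 1) = 0).image fun w => (i, w))
      ≤ ∑ _i : Fin 3, (n + 1) * p := by
        refine Finset.sum_le_sum fun i _ => Finset.card_image_le.trans ?_
        fin_cases i
        · exact card_cls_le c 0 1 2 (by decide) (by decide) (by decide) (hc 2)
        · exact card_cls_le c 1 0 2 (by decide) (by decide) (by decide) (hc 2)
        · exact card_cls_le c 2 0 1 (by decide) (by decide) (by decide) (hc 1)
    _ = 3 * ((n + 1) * p) := by simp

/-! ### Three solutions in one fibre are linearly dependent -/

/-- The heart of the fibre bound: three solutions `U 0, U 1, U 2` of `∑ cᵢ uᵢ^{n+1} = 0` in the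
box `|u l| ≤ Z l`, with equal signatures modulo the `v_k^e` (`v_k^e ∣ c_k`) and in the same class
modulo the auxiliary prime `p`, are linearly dependent as soon as
`6 Z₀Z₁Z₂ < (v₀v₁v₂)^e p³`. [folklore] -/
theorem det_eq_zero_of_congruences {n e : ℕ} (v : Fin 3 → ℕ) (hv : ∀ i, 0 < v i)
    (hvc : ∀ i j, i ≠ j → (v i).Coprime (v j)) (c : Fin 3 → ℤ)
    {p : ℕ} (hp : p.Prime) (hpd : ¬ (p ∣ n + 1)) (hpc : ∀ i, ¬ ((p : ℤ) ∣ c i))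
    (hpv : ∀ k, ¬ (p ∣ v k))
    (Z : Fin 3 → ℕ) (hsize : 6 * (Z 0 * Z 1 * Z 2) < (v 0 * v 1 * v 2) ^ e * p ^ 3)
    (U : Fin 3 → Fin 3 → ℤ) (hbox : ∀ r l, |U r l| ≤ Z l)
    (hcop : ∀ r i k, i ≠ k → IsCoprime (U r i) (v k : ℤ))
    (hF : ∀ r, ∑ i, c i * U r i ^ (n + 1) = 0)
    (hsg0 : ∀ r, (U r 1 : ZMod (v 0 ^ e)) * ((U r 2 : ZMod (v 0 ^ e)))⁻¹
      = (U 0 1 : ZMod (v 0 ^ e)) * ((U 0 2 : ZMod (v 0 ^ e)))⁻¹)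
    (hsg1 : ∀ r, (U r 0 : ZMod (v 1 ^ e)) * ((U r 2 : ZMod (v 1 ^ e)))⁻¹
      = (U 0 0 : ZMod (v 1 ^ e)) * ((U 0 2 : ZMod (v 1 ^ e)))⁻¹)
    (hsg2 : ∀ r, (U r 0 : ZMod (v 2 ^ e)) * ((U r 1 : ZMod (v 2 ^ e)))⁻¹
      = (U 0 0 : ZMod (v 2 ^ e)) * ((U 0 1 : ZMod (v 2 ^ e)))⁻¹)
    (i₀ : Fin 3) (hi₀ : ∀ r, ¬ ((p : ℤ) ∣ U r i₀))
    (hcl : ∀ r l, (U r l : ZMod p) * ((U r i₀ : ZMod p))⁻¹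
      = (U 0 l : ZMod p) * ((U 0 i₀ : ZMod p))⁻¹) :
    (Matrix.of U).det = 0 := by
  classical
  haveI : Fact p.Prime := ⟨hp⟩
  haveI hne : ∀ k, NeZero (v k ^ e) := fun k => ⟨pow_ne_zero _ (hv k).ne'⟩
  have hpZ : Prime (p : ℤ) := Nat.prime_iff_prime_int.mp hp
  set M := Matrix.of U with hMdef
  -- (i) divisibility by the moduli `v_k^e`
  have hcopv : ∀ r i k, i ≠ k → IsCoprime (U r i) ((v k ^ e : ℕ) : ℤ) := fun r i k hik => by
    rw [Nat.cast_pow]; exact (hcop r i k hik).pow_right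
  have hd0 : ((v 0 : ℤ) ^ e) ∣ M.det := by
    have := dvd_det_of_dvd_minors₀ M ((v 0 ^ e : ℕ) : ℤ) fun r s =>
      dvd_minor_of_sig_eq (U r 1) (U r 2) (U s 1) (U s 2) (hcopv r 2 0 (by decide))
        (hcopv s 2 0 (by decide)) ((hsg0 r).trans (hsg0 s).symm)
    simpa using this
  have hd1 : ((v 1 : ℤ) ^ e) ∣ M.det := by
    have := dvd_det_of_dvd_minors₁ M ((v 1 ^ e : ℕ) : ℤ) fun r s =>
      dvd_minor_of_sig_eq (U r 0) (U r 2) (U s 0) (U s 2) (hcopv r 2 1 (by decide))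
        (hcopv s 2 1 (by decide)) ((hsg1 r).trans (hsg1 s).symm)
    simpa using this
  have hd2 : ((v 2 : ℤ) ^ e) ∣ M.det := by
    have := dvd_det_of_dvd_minors₂ M ((v 2 ^ e : ℕ) : ℤ) fun r s =>
      dvd_minor_of_sig_eq (U r 0) (U r 1) (U s 0) (U s 1) (hcopv r 1 2 (by decide))
        (hcopv s 1 2 (by decide)) ((hsg2 r).trans (hsg2 s).symm)
    simpa using this
  -- (ii) divisibility by `p³`
  have hinv : ∀ r, ((U r i₀ : ℤ) : ZMod p) * (((U r i₀ : ℤ) : ZMod p))⁻¹ = 1 := fun r =>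
    mul_inv_cast_eq_one_of_isCoprime ((hpZ.irreducible.coprime_iff_not_dvd.2 (hi₀ r)).symm)
  set w : Fin 3 → ℤ := fun l =>
    if l = i₀ then 1 else ((((U 0 l : ZMod p) * ((U 0 i₀ : ZMod p))⁻¹).val : ℕ) : ℤ) with hw
  have hwcast : ∀ l, (w l : ZMod p) = (U 0 l : ZMod p) * ((U 0 i₀ : ZMod p))⁻¹ := by
    intro l
    by_cases hl : l = i₀
    · subst hl; simp [hw, hinv 0]
    · simp [hw, hl]
  have hd3 : (p : ℤ) ^ 3 ∣ M.det := by
    refine pow_three_dvd_det_of_cls (n := n) c w hpZ i₀ (by simp [hw]) ?_ ?_ hpc M ?_ hi₀ ?_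
    · rw [← ZMod.intCast_zmod_eq_zero_iff_dvd]
      push_cast
      simp_rw [hwcast, mul_pow, ← mul_assoc, ← Finset.sum_mul]
      have h0 := congrArg (Int.cast : ℤ → ZMod p) (hF 0)
      push_cast at h0
      rw [h0, zero_mul]
    · intro h
      apply hpd
      have : ((n : ℤ) + 1) = ((n + 1 : ℕ) : ℤ) := by push_cast; ring
      rw [this] at h
      exact Int.natCast_dvd_natCast.mp h
    · intro r k
      rw [← ZMod.intCast_zmod_eq_zero_iff_dvd]
      push_cast
      change (U r k : ZMod p) - (U r i₀ : ZMod p) * (w k : ZMod p) = 0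
      rw [hwcast, ← hcl r k]
      calc (U r k : ZMod p) - (U r i₀ : ZMod p) * ((U r k : ZMod p) * ((U r i₀ : ZMod p))⁻¹)
          = (U r k : ZMod p) * (1 - (U r i₀ : ZMod p) * ((U r i₀ : ZMod p))⁻¹) := by ring
        _ = 0 := by rw [hinv r, sub_self, mul_zero]
    · intro r
      change (p : ℤ) ^ 2 ∣ ∑ i, c i * U r i ^ (n + 1)
      rw [hF r]
      exact dvd_zero _
  -- (iii) the product divides the determinant, and is too large
  have hc01 : IsCoprime ((v 0 : ℤ) ^ e) ((v 1 : ℤ) ^ e) :=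
    (Nat.isCoprime_iff_coprime.mpr (hvc 0 1 (by decide))).pow
  have hc02 : IsCoprime ((v 0 : ℤ) ^ e) ((v 2 : ℤ) ^ e) :=
    (Nat.isCoprime_iff_coprime.mpr (hvc 0 2 (by decide))).pow
  have hc12 : IsCoprime ((v 1 : ℤ) ^ e) ((v 2 : ℤ) ^ e) :=
    (Nat.isCoprime_iff_coprime.mpr (hvc 1 2 (by decide))).pow
  have hcp : ∀ k, IsCoprime ((v k : ℤ) ^ e) ((p : ℤ) ^ 3) := fun k =>
    (Nat.isCoprime_iff_coprime.mpr ((Nat.coprime_comm.mp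
      ((Nat.Prime.coprime_iff_not_dvd hp).mpr (hpv k))))).pow
  have hprod : ((v 0 : ℤ) ^ e * (v 1 : ℤ) ^ e * (v 2 : ℤ) ^ e * (p : ℤ) ^ 3) ∣ M.det :=
    IsCoprime.mul_dvd (((hcp 0).mul_left (hcp 1)).mul_left (hcp 2))
      (IsCoprime.mul_dvd (hc02.mul_left hc12) (IsCoprime.mul_dvd hc01 hd0 hd1) hd2) hd3
  by_contra hne0
  have h1 := Int.natAbs_le_of_dvd_ne_zero hprod hne0
  have h2 := abs_det_le_of_rows_le M (fun l => (Z l : ℤ)) (fun r l => hbox r l)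
  have h2' : |M.det| ≤ 6 * ((Z 0 : ℤ) * Z 1 * Z 2) := h2
  have h3 : 6 * ((Z 0 : ℤ) * Z 1 * Z 2)
      < (v 0 : ℤ) ^ e * (v 1 : ℤ) ^ e * (v 2 : ℤ) ^ e * (p : ℤ) ^ 3 := by
    have h := (Nat.cast_lt (α := ℤ)).mpr hsize
    push_cast at h
    have h' : ((v 0 : ℤ) * v 1 * v 2) ^ e * (p : ℤ) ^ 3
        = (v 0 : ℤ) ^ e * (v 1 : ℤ) ^ e * (v 2 : ℤ) ^ e * (p : ℤ) ^ 3 := by ring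
    linarith
  have h5 : (((v 0 : ℤ) ^ e * (v 1 : ℤ) ^ e * (v 2 : ℤ) ^ e * (p : ℤ) ^ 3).natAbs : ℤ)
      = (v 0 : ℤ) ^ e * (v 1 : ℤ) ^ e * (v 2 : ℤ) ^ e * (p : ℤ) ^ 3 := by
    rw [Int.natCast_natAbs, abs_of_nonneg (by positivity)]
  have h6 : ((M.det).natAbs : ℤ) = |M.det| := Int.natCast_natAbs _
  have h7 : (((v 0 : ℤ) ^ e * (v 1 : ℤ) ^ e * (v 2 : ℤ) ^ e * (p : ℤ) ^ 3).natAbs : ℤ)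
      ≤ ((M.det).natAbs : ℤ) := by exact_mod_cast h1
  rw [h5, h6] at h7
  linarith

/-- **The fibre bound** (elementary determinant method, after Heath-Brown; the shape of Lemma 3
of Browning–Van Valckenborgh 2012 with the lattice index `(v₀v₁v₂)^e`). Fix pairwise coprime
`v₀, v₁, v₂ ≥ 1`, coefficients `cᵢ ≠ 0` with `vₖ^e ∣ cₖ` and `cᵢ` coprime to `vₖ` (`i ≠ k`), a
prime `p ∤ (n+1) c₀c₁c₂ v₀v₁v₂` and a box `Z` with `6 Z₀Z₁Z₂ < (v₀v₁v₂)^e p³`. Then the number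
of `u ∈ ℤ³`, `|uᵢ| ≤ Zᵢ`, with pairwise coprime coordinates, `uᵢ` coprime to `vₖ` (`i ≠ k`)
and `∑ cᵢ uᵢ^{n+1} = 0` is at most
`2(n+2) · 3(n+1)p · ∏ₖ #{ρ ∈ ℤ/vₖ^e : ρ^{n+1} = 1}`. [folklore] -/
theorem fiberBound {n e : ℕ} (hn : 1 ≤ n) (v : Fin 3 → ℕ) (hv : ∀ i, 0 < v i)
    (hvc : ∀ i j, i ≠ j → (v i).Coprime (v j)) (c : Fin 3 → ℤ) (hc0 : ∀ i, c i ≠ 0)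
    (hcv : ∀ k, ((v k : ℤ) ^ e) ∣ c k) (hcu : ∀ i k, i ≠ k → IsCoprime (c i) (v k : ℤ))
    {p : ℕ} (hp : p.Prime) (hpd : ¬ (p ∣ n + 1)) (hpc : ∀ i, ¬ ((p : ℤ) ∣ c i))
    (hpv : ∀ k, ¬ (p ∣ v k))
    (Z : Fin 3 → ℕ) (hsize : 6 * (Z 0 * Z 1 * Z 2) < (v 0 * v 1 * v 2) ^ e * p ^ 3) :
    #((Fintype.piFinset fun i => Finset.Icc (-(Z i : ℤ)) (Z i)).filter fun u =>
        (∀ i j, i ≠ j → IsCoprime (u i) (u j)) ∧ (∀ i k, i ≠ k → IsCoprime (u i) (v k : ℤ)) ∧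
        ∑ i, c i * u i ^ (n + 1) = 0)
      ≤ 2 * (n + 2) * (3 * ((n + 1) * p)) *
        ∏ k, Nat.card {ρ : ZMod (v k ^ e) // ρ ^ (n + 1) = 1} := by
  classical
  haveI : Fact p.Prime := ⟨hp⟩
  haveI hne : ∀ k, NeZero (v k ^ e) := fun k => ⟨pow_ne_zero _ (hv k).ne'⟩
  have hpZ : Prime (p : ℤ) := Nat.prime_iff_prime_int.mp hp
  set S := (Fintype.piFinset fun i => Finset.Icc (-(Z i : ℤ)) (Z i)).filter fun u =>
        (∀ i j, i ≠ j → IsCoprime (u i) (u j)) ∧ (∀ i k, i ≠ k → IsCoprime (u i) (v k : ℤ)) ∧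
        ∑ i, c i * u i ^ (n + 1) = 0 with hSdef
  have hS : ∀ u ∈ S, (∀ i, |u i| ≤ Z i) ∧ (∀ i j, i ≠ j → IsCoprime (u i) (u j)) ∧
      (∀ i k, i ≠ k → IsCoprime (u i) (v k : ℤ)) ∧ ∑ i, c i * u i ^ (n + 1) = 0 := by
    intro u hu
    simp only [hSdef, Finset.mem_filter, Fintype.mem_piFinset, Finset.mem_Icc] at hu
    exact ⟨fun i => abs_le.2 (hu.1 i), hu.2.1, hu.2.2.1, hu.2.2.2⟩
  have hprim : ∀ u ∈ S, ∃ b : Fin 3 → ℤ, ∑ i, b i * u i = 1 := by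
    intro u hu
    obtain ⟨x, y, hxy⟩ := (hS u hu).2.1 0 1 (by decide)
    exact ⟨![x, y, 0], by simp [Fin.sum_univ_three, hxy]⟩
  -- the pivot and the class modulo `p`
  let i₀ : (Fin 3 → ℤ) → Fin 3 := fun u => if (p : ℤ) ∣ u 0 then 1 else 0
  have hi₀ : ∀ u ∈ S, ¬ ((p : ℤ) ∣ u (i₀ u)) := by
    intro u hu
    by_cases h : (p : ℤ) ∣ u 0
    · simp only [i₀, h, if_true]
      intro h1
      exact hpZ.not_unit (((hS u hu).2.1 0 1 (by decide)).isUnit_of_dvd' h h1)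
    · simp [i₀, h]
  let cl : (Fin 3 → ℤ) → Fin 3 × (Fin 3 → ZMod p) := fun u =>
    (i₀ u, fun l => (u l : ZMod p) * ((u (i₀ u) : ZMod p))⁻¹)
  let sg : (Fin 3 → ℤ) → ZMod (v 0 ^ e) × ZMod (v 1 ^ e) × ZMod (v 2 ^ e) := fun u =>
    ((u 1 : ZMod (v 0 ^ e)) * ((u 2 : ZMod (v 0 ^ e)))⁻¹,
     (u 0 : ZMod (v 1 ^ e)) * ((u 2 : ZMod (v 1 ^ e)))⁻¹,
     (u 0 : ZMod (v 2 ^ e)) * ((u 1 : ZMod (v 2 ^ e)))⁻¹)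
  let f : (Fin 3 → ℤ) → (ZMod (v 0 ^ e) × ZMod (v 1 ^ e) × ZMod (v 2 ^ e)) ×
      (Fin 3 × (Fin 3 → ZMod p)) := fun u => (sg u, cl u)
  -- Step 1: the fibres of `f` are "parts"
  have hfib : ∀ q ∈ S.image f, #(S.filter fun u => f u = q) ≤ 2 * (n + 2) := by
    intro q _
    have hTS : ∀ u ∈ S.filter (fun u => f u = q), u ∈ S := fun u hu => (Finset.mem_filter.mp hu).1
    have hTf : ∀ u ∈ S.filter (fun u => f u = q), f u = q := fun u hu => (Finset.mem_filter.mp hu).2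
    refine card_part_le hn c hc0 _ (fun u hu => hprim u (hTS u hu))
      (fun u hu => (hS u (hTS u hu)).2.2.2) ?_
    intro z₁ hz₁ z₂ hz₂ z₃ hz₃
    let U : Fin 3 → Fin 3 → ℤ := ![z₁, z₂, z₃]
    have hU : ∀ r, U r ∈ S.filter (fun u => f u = q) := by
      intro r; fin_cases r
      · exact hz₁
      · exact hz₂
      · exact hz₃
    have hfU : ∀ r, f (U r) = f (U 0) := fun r => (hTf _ (hU r)).trans (hTf _ (hU 0)).symm
    have hsgU : ∀ r, sg (U r) = sg (U 0) := fun r => congrArg Prod.fst (hfU r)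
    have hclU : ∀ r, cl (U r) = cl (U 0) := fun r => congrArg Prod.snd (hfU r)
    have hiU : ∀ r, i₀ (U r) = i₀ (U 0) := fun r => congrArg Prod.fst (hclU r)
    change (Matrix.of U).det = 0
    refine det_eq_zero_of_congruences v hv hvc c hp hpd hpc hpv Z hsize U
      (fun r l => (hS _ (hTS _ (hU r))).1 l) (fun r i k hik => (hS _ (hTS _ (hU r))).2.2.1 i k hik)
      (fun r => (hS _ (hTS _ (hU r))).2.2.2)
      (fun r => congrArg Prod.fst (hsgU r))
      (fun r => congrArg Prod.fst (congrArg Prod.snd (hsgU r)))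
      (fun r => congrArg Prod.snd (congrArg Prod.snd (hsgU r)))
      (i₀ (U 0)) (fun r => by rw [← hiU r]; exact hi₀ _ (hTS _ (hU r))) (fun r l => ?_)
    have h2 := congrFun (congrArg Prod.snd (hclU r)) l
    simp only [cl] at h2
    rw [hiU r] at h2
    exact h2
  -- Step 2: the image of `f`
  set U₀ : ZMod (v 0 ^ e) := -(c 2 : ZMod (v 0 ^ e)) * ((c 1 : ZMod (v 0 ^ e)))⁻¹ with hU₀
  set U₁ : ZMod (v 1 ^ e) := -(c 2 : ZMod (v 1 ^ e)) * ((c 0 : ZMod (v 1 ^ e)))⁻¹ with hU₁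
  set U₂ : ZMod (v 2 ^ e) := -(c 1 : ZMod (v 2 ^ e)) * ((c 0 : ZMod (v 2 ^ e)))⁻¹ with hU₂
  set SigSet := (Finset.univ.filter fun ρ : ZMod (v 0 ^ e) => ρ ^ (n + 1) = U₀) ×ˢ
    ((Finset.univ.filter fun ρ : ZMod (v 1 ^ e) => ρ ^ (n + 1) = U₁) ×ˢ
     (Finset.univ.filter fun ρ : ZMod (v 2 ^ e) => ρ ^ (n + 1) = U₂)) with hSigSet
  set ClsSet := Finset.univ.filter fun q : Fin 3 × (Fin 3 → ZMod p) =>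
    q.2 q.1 = 1 ∧ ∑ l, (c l : ZMod p) * q.2 l ^ (n + 1) = 0 with hClsSet
  have hcopv : ∀ u ∈ S, ∀ i k, i ≠ k → IsCoprime (u i) ((v k ^ e : ℕ) : ℤ) :=
    fun u hu i k hik => by rw [Nat.cast_pow]; exact ((hS u hu).2.2.1 i k hik).pow_right
  have hcuv : ∀ i k, i ≠ k → IsCoprime (c i) ((v k ^ e : ℕ) : ℤ) :=
    fun i k hik => by rw [Nat.cast_pow]; exact (hcu i k hik).pow_right
  have himg : S.image f ⊆ SigSet ×ˢ ClsSet := by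
    intro q hq
    obtain ⟨u, hu, rfl⟩ := Finset.mem_image.mp hq
    have hFu := (hS u hu).2.2.2
    have hFu3 : c 0 * u 0 ^ (n + 1) + c 1 * u 1 ^ (n + 1) + c 2 * u 2 ^ (n + 1) = 0 := by
      simpa [Fin.sum_univ_three] using hFu
    simp only [hSigSet, hClsSet, Finset.mem_product, Finset.mem_filter, Finset.mem_univ, true_and,
      f, sg, cl]
    refine ⟨⟨?_, ?_, ?_⟩, ?_, ?_⟩
    · refine sig_pow_eq (u 1) (u 2) (c 1) (c 2) (hcopv u hu 2 0 (by decide))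
        (hcuv 1 0 (by decide)) ?_
      have : c 1 * u 1 ^ (n + 1) + c 2 * u 2 ^ (n + 1) = -(c 0 * u 0 ^ (n + 1)) := by linarith
      rw [this, dvd_neg, Nat.cast_pow]
      exact (hcv 0).mul_right _
    · refine sig_pow_eq (u 0) (u 2) (c 0) (c 2) (hcopv u hu 2 1 (by decide))
        (hcuv 0 1 (by decide)) ?_
      have : c 0 * u 0 ^ (n + 1) + c 2 * u 2 ^ (n + 1) = -(c 1 * u 1 ^ (n + 1)) := by linarith
      rw [this, dvd_neg, Nat.cast_pow]
      exact (hcv 1).mul_right _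
    · refine sig_pow_eq (u 0) (u 1) (c 0) (c 1) (hcopv u hu 1 2 (by decide))
        (hcuv 0 2 (by decide)) ?_
      have : c 0 * u 0 ^ (n + 1) + c 1 * u 1 ^ (n + 1) = -(c 2 * u 2 ^ (n + 1)) := by linarith
      rw [this, dvd_neg, Nat.cast_pow]
      exact (hcv 2).mul_right _
    · exact mul_inv_cast_eq_one_of_isCoprime
        ((hpZ.irreducible.coprime_iff_not_dvd.2 (hi₀ u hu)).symm)
    · simp_rw [mul_pow, ← mul_assoc, ← Finset.sum_mul]
      have h0 := congrArg (Int.cast : ℤ → ZMod p) hFu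
      push_cast at h0
      rw [h0, zero_mul]
  -- Step 3: counting
  have hunitc : ∀ i k, i ≠ k → IsUnit ((c i : ZMod (v k ^ e))) := fun i k hik =>
    IsUnit.of_mul_eq_one _ (mul_inv_cast_eq_one_of_isCoprime (hcuv i k hik))
  have hunit_inv : ∀ i k, i ≠ k → IsUnit (((c i : ZMod (v k ^ e)))⁻¹) := fun i k hik =>
    IsUnit.of_mul_eq_one (c i : ZMod (v k ^ e))
      (by rw [mul_comm]; exact mul_inv_cast_eq_one_of_isCoprime (hcuv i k hik))
  have hSig : #SigSet ≤ Nat.card {ρ : ZMod (v 0 ^ e) // ρ ^ (n + 1) = 1} *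
      (Nat.card {ρ : ZMod (v 1 ^ e) // ρ ^ (n + 1) = 1} *
       Nat.card {ρ : ZMod (v 2 ^ e) // ρ ^ (n + 1) = 1}) := by
    rw [hSigSet, Finset.card_product, Finset.card_product]
    gcongr
    · exact card_filter_pow_eq_le U₀
        ((hunitc 2 0 (by decide)).neg.mul (hunit_inv 1 0 (by decide))) (Nat.succ_ne_zero n)
    · exact card_filter_pow_eq_le U₁
        ((hunitc 2 1 (by decide)).neg.mul (hunit_inv 0 1 (by decide))) (Nat.succ_ne_zero n)
    · exact card_filter_pow_eq_le U₂
        ((hunitc 1 2 (by decide)).neg.mul (hunit_inv 0 2 (by decide))) (Nat.succ_ne_zero n)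
  have hCls : #ClsSet ≤ 3 * ((n + 1) * p) := by
    rw [hClsSet]
    refine card_clsSet_le (fun l => (c l : ZMod p)) fun k => ?_
    rw [Ne, ZMod.intCast_zmod_eq_zero_iff_dvd]
    exact hpc k
  calc #S ≤ 2 * (n + 2) * #(S.image f) := Finset.card_le_mul_card_image S _ hfib
    _ ≤ 2 * (n + 2) * #(SigSet ×ˢ ClsSet) := by gcongr
    _ = 2 * (n + 2) * (#SigSet * #ClsSet) := by rw [Finset.card_product]
    _ ≤ 2 * (n + 2) * ((Nat.card {ρ : ZMod (v 0 ^ e) // ρ ^ (n + 1) = 1} *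
        (Nat.card {ρ : ZMod (v 1 ^ e) // ρ ^ (n + 1) = 1} *
         Nat.card {ρ : ZMod (v 2 ^ e) // ρ ^ (n + 1) = 1})) * (3 * ((n + 1) * p))) := by gcongr
    _ = 2 * (n + 2) * (3 * ((n + 1) * p)) *
        ∏ k, Nat.card {ρ : ZMod (v k ^ e) // ρ ^ (n + 1) = 1} := by
        rw [Fin.prod_univ_three]; ring

end SquarefulDet

end Literature.NumberTheory.DiophantineGeometry
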